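import Summits.CriticalPhenomena.PercolationContinuityZ3.Theorems.PercNearOneGluingNoHeavyLowerTailThresholdRABCounting
import Summits.CriticalPhenomena.PercolationContinuityZ3.Theorems.PercNearOneGluingNoHeavyLowerTailThresholdTwoThreePartition
import Summits.CriticalPhenomena.PercolationContinuityZ3.Theorems.PercNearOneGluingNoHeavyLowerTailThresholdRABCond

/-!
# `NoHeavyLowerTail` (crux stmt-CriticalPhenomena-4575), lane prim-ineq-gen-4 (gen 18): **THREE-PARTITION POSITIVITY WITH THE THRESHOLD SLOT
# `Θ_k = {T : k ≤ |T|}` FOR EVERY `k`, in every dimension satisfying the counting condition `COND(ι,k)`**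

Support file (`--supports stmt-CriticalPhenomena-4575`; memo `run/shared/lean/prim/prim-ineq-gen-4/PROOFS-RAB-ALL-K-g18.md`, Theorem 3 /
§8b).  Pure proofs, no definitions, no `sorry`, standard axioms.

THEOREM (`threePartN_threshold_nonneg`): for a finite type `ι`, `k : ℕ`, and up-sets `V, W ⊆ 𝒫(ι)`,
`0 ≤ ThreePartition.threePartN {T | k ≤ T.ncard} V W`, PROVIDED `COND(ι,k)`: for every finset `u` with `1 ≤ #u < k`,
`#{u' : 1 ≤ #u' < k} · #{Y ⊇ u : #Y + 3 ≤ 2k, k ≤ #Yᶜ} ≤ #{Y ⊇ u : 2k ≤ #Y + 1, k ≤ #Yᶜ}` — a numeric condition on `(card ι, k)`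
alone, true for all `card ι ≥ n₀''(k) = O(k)` (memo §8b; e.g. vacuous for `k ≤ 1`).  This is the lane's conjecture
`ThreePartitionPositivity` for every THRESHOLD slot in all large dimensions (gen 17 did `k = 2`, all dimensions `≥ 4`).
PROOF: the counting form `ThresholdRAB.threshold_counting` (natural spectator certificate: fibre lemma (RAB_k) for all `k`, its strict
form, and a double count), transported to `threePartN` exactly as in gen-17's `…ThresholdTwoThreePartition` (whose transport lemmas are reused).
-/

noncomputable section

open Finset
open scoped Classical

namespace Summit.CriticalPhenomena.PercolationContinuityZ3.Theorems.ThreePartition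

variable {ι : Type*} [Fintype ι]

/-- The threshold family `Θ_k = {T | k ≤ T.ncard}` is an up-set. [folklore] -/
theorem isUpperSet_threshold (k : ℕ) : IsUpperSet {T : Set ι | k ≤ T.ncard} :=
  fun _ _ hab ha => le_trans ha (Set.ncard_le_ncard hab (Set.toFinite _))

/-- **Three-partition positivity for the threshold slot `Θ_k`, every `k`, under the counting condition `COND(ι,k)`.** [this work] -/
theorem threePartN_threshold_nonneg [DecidableEq ι] (k : ℕ)
    (hcond : ∀ u : Finset ι, 1 ≤ #u → #u < k →
      #((univ : Finset (Finset ι)).filter fun u' => 1 ≤ #u' ∧ #u' < k)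
          * #((univ : Finset (Finset ι)).filter fun Y => (#Y + 3 ≤ 2 * k ∧ k ≤ #Yᶜ) ∧ u ⊆ Y)
        ≤ #((univ : Finset (Finset ι)).filter fun Y => (2 * k ≤ #Y + 1 ∧ k ≤ #Yᶜ) ∧ u ⊆ Y))
    (V W : Set (Set ι)) (hV : IsUpperSet V) (hW : IsUpperSet W) :
    0 ≤ threePartN {T : Set ι | k ≤ T.ncard} V W := by
  by_cases hV0 : (∅ : Set ι) ∈ V
  · rw [eq_univ_of_empty_mem hV hV0, threePartN_swap12]
    exact threePartN_univ_nonneg (isUpperSet_threshold k) hW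
  by_cases hW0 : (∅ : Set ι) ∈ W
  · rw [eq_univ_of_empty_mem hW hW0, threePartN_swap13]
    exact threePartN_univ_nonneg hV (isUpperSet_threshold k)
  set V' : Finset (Finset ι) := univ.filter fun s => (s : Set ι) ∈ V with hV'
  set W' : Finset (Finset ι) := univ.filter fun s => (s : Set ι) ∈ W with hW'
  have hmV : ∀ s : Finset ι, s ∈ V' ↔ (s : Set ι) ∈ V := fun s => by
    rw [hV', mem_filter]; exact ⟨fun h => h.2, fun h => ⟨mem_univ _, h⟩⟩
  have hmW : ∀ s : Finset ι, s ∈ W' ↔ (s : Set ι) ∈ W := fun s => by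
    rw [hW', mem_filter]; exact ⟨fun h => h.2, fun h => ⟨mem_univ _, h⟩⟩
  have hV'up : IsUpperSet (V' : Set (Finset ι)) := by
    intro a b hab ha
    rw [mem_coe, hmV] at ha ⊢
    exact hV (coe_subset.2 hab) ha
  have hW'up : IsUpperSet (W' : Set (Finset ι)) := by
    intro a b hab ha
    rw [mem_coe, hmW] at ha ⊢
    exact hW (coe_subset.2 hab) ha
  have hV'0 : (∅ : Finset ι) ∉ V' := fun h => hV0 (by rw [hmV, coe_empty] at h; exact h)
  have hW'0 : (∅ : Finset ι) ∉ W' := fun h => hW0 (by rw [hmW, coe_empty] at h; exact h)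
  have hcount := ThresholdRAB.threshold_counting V' W' hV'up hW'up hV'0 k hcond
  have hΘ : ∀ s : Finset ι, ((s : Set ι) ∈ {T : Set ι | k ≤ T.ncard}) ↔ k ≤ #s := fun s => by
    rw [Set.mem_setOf_eq, Set.ncard_coe_finset]
  have hΘc : ∀ a b : Finset ι, (((a : Set ι) ∪ (b : Set ι))ᶜ ∈ {T : Set ι | k ≤ T.ncard}) ↔ k ≤ #(a ∪ b)ᶜ :=
    fun a b => by rw [← coe_union, ← coe_compl, hΘ]
  have hmVc : ∀ a b : Finset ι, (((a : Set ι) ∪ (b : Set ι))ᶜ ∈ V) ↔ (a ∪ b)ᶜ ∈ V' :=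
    fun a b => by rw [← coe_union, ← coe_compl, hmV]
  have hmWc : ∀ a b : Finset ι, (((a : Set ι) ∪ (b : Set ι))ᶜ ∈ W) ↔ (a ∪ b)ᶜ ∈ W' :=
    fun a b => by rw [← coe_union, ← coe_compl, hmW]
  -- `top(Θ₂ ∩ V ∩ W)`: (S₁,S₂,S₃) ↦ (u,s) = (S₃,S₁)
  have e_top : top ({T : Set ι | k ≤ T.ncard} ∩ V ∩ W) =
      #((univ : Finset (Finset ι × Finset ι)).filter fun q => ((q.1 ∈ V' ∧ q.1 ∈ W') ∧ Disjoint q.1 q.2) ∧ k ≤ #q.1) := by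
    unfold top; rw [tri_eq_card_finsetPairs]
    refine card_bij' (fun r _ => ((r.1 ∪ r.2)ᶜ, r.1)) (fun q _ => (q.2, (q.2 ∪ q.1)ᶜ)) (fun r hr => ?_) (fun q hq => ?_)
      (fun r hr => ?_) (fun q hq => ?_)
    · simp only [mem_filter, mem_univ, true_and] at hr ⊢
      obtain ⟨hd, hm⟩ := hr
      rw [Set.mem_inter_iff, Set.mem_inter_iff, hΘc, hmVc, hmWc] at hm
      exact ⟨⟨⟨hm.1.2, hm.2⟩, disjoint_compl_union_left _ _⟩, hm.1.1⟩
    · simp only [mem_filter, mem_univ, true_and] at hq ⊢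
      obtain ⟨⟨⟨hv, hw⟩, hd⟩, h2⟩ := hq
      refine ⟨(disjoint_compl_union_left _ _).symm, ?_⟩
      rw [coe_union_coe_compl_union hd.symm, Set.mem_inter_iff, Set.mem_inter_iff, hΘ, ← hmV, ← hmW]
      exact ⟨⟨h2, hv⟩, hw⟩
    · simp only [mem_filter, mem_univ, true_and] at hr
      exact Prod.ext rfl (compl_union_compl_union hr.1)
    · simp only [mem_filter, mem_univ, true_and] at hq
      exact Prod.ext (compl_union_compl_union hq.1.2.symm) rfl
  -- `dee(Θ₂, V ∩ W)`: (S₁,S₂,S₃) ↦ (u,a) = (S₃,S₁)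
  have e_deeU : dee {T : Set ι | k ≤ T.ncard} (V ∩ W) =
      #((univ : Finset (Finset ι × Finset ι)).filter fun q => ((q.1 ∈ V' ∧ q.1 ∈ W') ∧ Disjoint q.1 q.2) ∧ k ≤ #q.2) := by
    unfold dee; rw [tri_eq_card_finsetPairs]
    refine card_bij' (fun r _ => ((r.1 ∪ r.2)ᶜ, r.1)) (fun q _ => (q.2, (q.2 ∪ q.1)ᶜ)) (fun r hr => ?_) (fun q hq => ?_)
      (fun r hr => ?_) (fun q hq => ?_)
    · simp only [mem_filter, mem_univ, true_and] at hr ⊢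
      obtain ⟨hd, h1, hm⟩ := hr
      rw [Set.mem_inter_iff, hmVc, hmWc] at hm
      rw [hΘ] at h1
      exact ⟨⟨⟨hm.1, hm.2⟩, disjoint_compl_union_left _ _⟩, h1⟩
    · simp only [mem_filter, mem_univ, true_and] at hq ⊢
      obtain ⟨⟨⟨hv, hw⟩, hd⟩, h2⟩ := hq
      refine ⟨(disjoint_compl_union_left _ _).symm, (hΘ _).2 h2, ?_⟩
      rw [coe_union_coe_compl_union hd.symm, Set.mem_inter_iff, ← hmV, ← hmW]
      exact ⟨hv, hw⟩
    · simp only [mem_filter, mem_univ, true_and] at hr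
      exact Prod.ext rfl (compl_union_compl_union hr.1)
    · simp only [mem_filter, mem_univ, true_and] at hq
      exact Prod.ext (compl_union_compl_union hq.1.2.symm) rfl
  -- `dee(V, Θ₂ ∩ W)`: (S₁,S₂,S₃) ↦ (v,w) = (S₁,S₃)
  have e_deeV : dee V ({T : Set ι | k ≤ T.ncard} ∩ W) =
      #((univ : Finset (Finset ι × Finset ι)).filter fun q => (q.1 ∈ V' ∧ q.2 ∈ W' ∧ Disjoint q.1 q.2) ∧ k ≤ #q.2) := by
    unfold dee; rw [tri_eq_card_finsetPairs]
    refine card_bij' (fun r _ => (r.1, (r.1 ∪ r.2)ᶜ)) (fun q _ => (q.1, (q.1 ∪ q.2)ᶜ)) (fun r hr => ?_) (fun q hq => ?_)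
      (fun r hr => ?_) (fun q hq => ?_)
    · simp only [mem_filter, mem_univ, true_and] at hr ⊢
      obtain ⟨hd, h1, hm⟩ := hr
      rw [Set.mem_inter_iff, hΘc, hmWc] at hm
      rw [← hmV] at h1
      exact ⟨⟨h1, hm.2, (disjoint_compl_union_left _ _).symm⟩, hm.1⟩
    · simp only [mem_filter, mem_univ, true_and] at hq ⊢
      obtain ⟨⟨hv, hw, hd⟩, h2⟩ := hq
      refine ⟨(disjoint_compl_union_left _ _).symm, (hmV _).1 hv, ?_⟩
      rw [coe_union_coe_compl_union hd, Set.mem_inter_iff, hΘ, ← hmW]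
      exact ⟨h2, hw⟩
    · simp only [mem_filter, mem_univ, true_and] at hr
      exact Prod.ext rfl (compl_union_compl_union hr.1)
    · simp only [mem_filter, mem_univ, true_and] at hq
      exact Prod.ext rfl (compl_union_compl_union hq.1.2.2)
  -- `dee(W, Θ₂ ∩ V)`: (S₁,S₂,S₃) ↦ (v,w) = (S₃,S₁)
  have e_deeW : dee W ({T : Set ι | k ≤ T.ncard} ∩ V) =
      #((univ : Finset (Finset ι × Finset ι)).filter fun q => (q.1 ∈ V' ∧ q.2 ∈ W' ∧ Disjoint q.1 q.2) ∧ k ≤ #q.1) := by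
    unfold dee; rw [tri_eq_card_finsetPairs]
    refine card_bij' (fun r _ => ((r.1 ∪ r.2)ᶜ, r.1)) (fun q _ => (q.2, (q.2 ∪ q.1)ᶜ)) (fun r hr => ?_) (fun q hq => ?_)
      (fun r hr => ?_) (fun q hq => ?_)
    · simp only [mem_filter, mem_univ, true_and] at hr ⊢
      obtain ⟨hd, h1, hm⟩ := hr
      rw [Set.mem_inter_iff, hΘc, hmVc] at hm
      rw [← hmW] at h1
      exact ⟨⟨hm.2, h1, disjoint_compl_union_left _ _⟩, hm.1⟩
    · simp only [mem_filter, mem_univ, true_and] at hq ⊢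
      obtain ⟨⟨hv, hw, hd⟩, h2⟩ := hq
      refine ⟨(disjoint_compl_union_left _ _).symm, (hmW _).1 hw, ?_⟩
      rw [coe_union_coe_compl_union hd.symm, Set.mem_inter_iff, hΘ, ← hmV]
      exact ⟨h2, hv⟩
    · simp only [mem_filter, mem_univ, true_and] at hr
      exact Prod.ext rfl (compl_union_compl_union hr.1)
    · simp only [mem_filter, mem_univ, true_and] at hq
      exact Prod.ext (compl_union_compl_union hq.1.2.2.symm) rfl
  -- `tee(Θ₂, V, W)`: (S₁,S₂,S₃) ↦ (v,w) = (S₂,S₃)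
  have e_tee : tee {T : Set ι | k ≤ T.ncard} V W =
      #((univ : Finset (Finset ι × Finset ι)).filter fun q =>
        (q.1 ∈ V' ∧ q.2 ∈ W' ∧ Disjoint q.1 q.2) ∧ k ≤ #(q.1 ∪ q.2)ᶜ) := by
    unfold tee; rw [tri_eq_card_finsetPairs]
    refine card_bij' (fun r _ => (r.2, (r.1 ∪ r.2)ᶜ)) (fun q _ => ((q.1 ∪ q.2)ᶜ, q.1)) (fun r hr => ?_) (fun q hq => ?_)
      (fun r hr => ?_) (fun q hq => ?_)
    · simp only [mem_filter, mem_univ, true_and] at hr ⊢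
      obtain ⟨hd, h1, h2, h3⟩ := hr
      rw [hΘ] at h1
      rw [← hmV] at h2
      rw [hmWc] at h3
      refine ⟨⟨h2, h3, ?_⟩, ?_⟩
      · exact disjoint_left.2 fun x hx hxc => (mem_compl.1 hxc) (mem_union_right _ hx)
      · rw [union_comm r.1 r.2, compl_union_compl_union hd.symm]; exact h1
    · simp only [mem_filter, mem_univ, true_and] at hq ⊢
      obtain ⟨⟨hv, hw, hd⟩, h2⟩ := hq
      refine ⟨disjoint_compl_union_left _ _, (hΘ _).2 h2, (hmV _).1 hv, ?_⟩
      rw [coe_compl_union_union_coe hd, ← hmW]; exact hw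
    · simp only [mem_filter, mem_univ, true_and] at hr
      refine Prod.ext ?_ rfl
      show (r.2 ∪ (r.1 ∪ r.2)ᶜ)ᶜ = r.1
      rw [union_comm r.1 r.2, compl_union_compl_union hr.1.symm]
    · simp only [mem_filter, mem_univ, true_and] at hq
      refine Prod.ext rfl ?_
      show ((q.1 ∪ q.2)ᶜ ∪ q.1)ᶜ = q.2
      exact compl_compl_union_union hq.1.2.2
  unfold threePartN
  rw [e_top, e_tee, e_deeU, e_deeV, e_deeW]
  push_cast
  omega


/-- **Numeric form**: the same, with `COND(ι,k)` replaced by its closed binomial form (`ThresholdRAB.cond_of_numeric`), `n = card ι`: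
for each `1 ≤ j < k`, `(Σ_{1≤i<k} C(n,i)) · Σ_l [j+l+3 ≤ 2k ∧ k ≤ n−j−l] C(n−j,l) ≤ Σ_l [2k ≤ j+l+1 ∧ k ≤ n−j−l] C(n−j,l)`. [this work] -/
theorem threePartN_threshold_nonneg_of_numeric [DecidableEq ι] (k : ℕ)
    (h : ∀ j, 1 ≤ j → j < k →
      (∑ i ∈ Ico 1 k, (Fintype.card ι).choose i)
          * (∑ l ∈ range (Fintype.card ι - j + 1),
              (if (j + l) + 3 ≤ 2 * k ∧ k ≤ Fintype.card ι - (j + l) then (Fintype.card ι - j).choose l else 0))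
        ≤ ∑ l ∈ range (Fintype.card ι - j + 1),
              (if 2 * k ≤ (j + l) + 1 ∧ k ≤ Fintype.card ι - (j + l) then (Fintype.card ι - j).choose l else 0))
    (V W : Set (Set ι)) (hV : IsUpperSet V) (hW : IsUpperSet W) :
    0 ≤ threePartN {T : Set ι | k ≤ T.ncard} V W :=
  threePartN_threshold_nonneg k (ThresholdRAB.cond_of_numeric k h) V W hV hW

/-- **Example: the threshold slot `Θ₃` on `15` points**, unconditionally (the numeric condition is settled by `decide`); the same one-liner
works for any concrete `(card ι, k)` in the range of memo §8b (`decide` cost grows with `card ι`). [this work] -/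
theorem threePartN_thresholdThree_nonneg_of_card_eq (hι : Fintype.card ι = 15) [DecidableEq ι]
    (V W : Set (Set ι)) (hV : IsUpperSet V) (hW : IsUpperSet W) :
    0 ≤ threePartN {T : Set ι | 3 ≤ T.ncard} V W :=
  threePartN_threshold_nonneg_of_numeric 3 (by rw [hι]; decide) V W hV hW

end Summit.CriticalPhenomena.PercolationContinuityZ3.Theorems.ThreePartition

end
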